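import Mathlib
import Summits.NavierStokesRegularity.FluidComputer.TransportGalerkinAbc
import Summits.NavierStokesRegularity.FluidComputer.TransportGalerkinEigen
import Summits.NavierStokesRegularity.FluidComputer.TransportSymDictionary
import Summits.NavierStokesRegularity.FluidComputer.AbcLatticeEigenSynthesis
import Literature.Analysis.FluidPDE.LinearisedNSLatticeEigenvalue
import Literature.Analysis.FluidPDE.KolmogorovShearLinearised
import HarnessLib

/-!
# The transport Galerkin model with coordinate functionals: the linearised field in the scalar-Fourier vocabulary, and classical eigenpairs read on the lattice (instab g18, cell `ns-blowup`, 2026-08-27)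

HONEST FRAMING (human ruling D-0035): nothing here is a claim about Navier–Stokes blow-up.
WHAT THIS IS NOT: not NS evidence — DICTIONARY identities between the (β2) chain's linearised
field `TransportGalerkinDefs.linCoeff / linOp` (symbol-calculus vocabulary `conv (scal ·) (freqDeriv ·)`,
`H²`-scaled phase space) for `V = ℂ^d`, `π_j = EuclideanSpace.proj j`, and the scalar-Fourier
vocabulary `ScalarFourier.transportSym` / `Torus.lerayCoeff` in which the tree's lattice eigen-synthesis
(`SteadyLattice.isLinNSEigenvalue_of_fourier_eigen`) and the cell's ABC certifier files
(`AbcLinearisedLattice`, `AbcLatticeEigenSynthesis`, `AbcLatticeReality`) are written; plus the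
converse of that synthesis: a CLASSICAL eigenpair of the linearisation read on the lattice.

* §1 `apply_conv_scal` / `apply_sum_conv_scal_freqDeriv` — components commute with the convergent
  convolution sums: `(∑_j (y_j ⋆ ∂_j g))(k)_p = transportSym y (g·_p)(k)` for bounded `y_j` and
  `∂_j g` with summable norms (`TransportSymDictionary` componentwise).
* §2 `sum_freqDeriv_freqDeriv_apply` — the lattice Laplacian symbol `∑_j ∂_j∂_j u (k) = −4π²|k|² u(k)`.
* §3 `linCoeff_proj_apply` — for rapidly decreasing host `Uv` and family `u` (general finite `d`):
  `linCoeff ν Uv proj u (k) = −( ν·4π²|k|² u(k) + [N(Uv, u)(k) + N(u, Uv)(k)] )`,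
  `N(a, b)(k)_p = transportSym (a··) (b·_p)(k)` as in `SteadyLattice`.
* §4 `coe_linOp_proj_lerayCLM_apply` — the coefficients of `linOp ν Uv proj lerayCLM x` on a rapidly
  decreasing `x ∈ E`: `−Λ²(k) • Π_k` of the bracket above at `û = Λ⁻² ⇑x`; **`linOp_eq_smul_of_fourier_eigen`**:
  a rapidly decaying, transversal, mean-free solution `c` of the tree's lattice eigen-equation
  `ν·4π²|k|² c(k) + Π_k[N(Uv,c) + N(c,Uv)](k) + μ c(k) = 0` (the hypothesis `heq` of
  `SteadyLattice.isLinNSEigenvalue_of_fourier_eigen`, i.e. `L c = μ c`) gives, scaled by `Λ²`, an EXACT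
  EIGENVECTOR of the (β2) operator with the SAME eigenvalue: `linOp ν Uv proj lerayCLM x = μ • x` for
  `⇑x = Λ² c` (e.g. `x = ofCoeff (Λ² c)`, `coe_ofCoeff_wmul`).
* §5 (`d = Fin 3`, `Uv = 𝓕(abcFlow A B C)`) `coe_linOp_abc_apply` — the certifiers' cross-product
  form `Π_k Σ_{s ∈ {±e_j}} Û(s) × (i(k−s) × û(k−s) − û(k−s))` of the same coefficients
  (`AbcLatticeEigenSynthesis.lerayCoeff_linSym_abcFlow`), i.e. the h₁/h₂/hL pairings of
  `half_prediction_abc` are pairings against `2π·Λ²·(−2πν|k|² Π_k û + Π_k X û)`.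
* §6 (`d = Fin 3`, general smooth real host `U`) **`fourier_eigen_of_linNSResolventRel`** — the
  converse of `SteadyLattice.isLinNSEigenvalue_of_fourier_eigen`: if `(μ, w)` is a classical eigenpair
  of `L(ν,U) w = νΔw − (U·∇)w − (w·∇)U − ∇q` (`Torus.LinNSResolventRel ν U μ w 0`), then `c = 𝓕w` is
  rapidly decaying, transversal, mean-free and solves the lattice eigen-equation (dictionary
  `SteadyLattice.mFourierCoeff_convect_complex / _stretch / _gradientC`, `Torus.mFourierCoeff_laplacian`,
  `KolmogorovShear.kdot_mFourierCoeff_eq_zero`, `Π_k k = 0`, `Π_k c(k) = c(k)`); `w ≠ 0 ⇒ c ≠ 0`.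

Mathlib + the tree files cited; no new definitions.
-/

noncomputable section

namespace Summit.NavierStokesRegularity.FluidComputer.TransportGalerkinEigenFourier

open Set Filter Topology Finset MeasureTheory UnitAddTorus
open Literature.Analysis.FunctionSpaces Literature.Analysis.FunctionSpaces.Lattice
open Literature.Analysis.FunctionSpaces.Torus Literature.Analysis.FunctionSpaces.EuclideanSpace
open Literature.Analysis.ODE
open Literature.Analysis.FluidPDE Literature.Analysis.FluidPDE.ScalarFourier
open Literature.Analysis.FluidPDE.SteadyLattice
open Summit.NavierStokesRegularity.FluidComputer.GalerkinLatticePhaseSpace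
open Summit.NavierStokesRegularity.FluidComputer.TransportGalerkin
open Summit.NavierStokesRegularity.FluidComputer.TransportGalerkinRapid
open Summit.NavierStokesRegularity.FluidComputer.TransportGalerkinLipschitz
open Summit.NavierStokesRegularity.FluidComputer.TransportGalerkinAbc
open Summit.NavierStokesRegularity.FluidComputer.TransportGalerkinEigen
open Summit.NavierStokesRegularity.FluidComputer.TransportSymDictionary
open scoped ENNReal NNReal ComplexConjugate InnerProductSpace

/-! ## §1 Components commute with the convolution sums -/

section Components

variable {d : Type*} [Fintype d] [DecidableEq d]

omit [Fintype d] [DecidableEq d] in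
/-- **A component of a scalar-symbol convolution** is the scalar convolution of that component, when
the convolution sum converges: `((χ ⋆ g)(k))_p = ∑_l χ(k−l) · g(l)_p`. -/
theorem apply_conv_scal [Fintype d] (χ : (d → ℤ) → ℂ) (g : (d → ℤ) → EuclideanSpace ℂ d) (k : d → ℤ) (p : d)
    (hs : Summable fun l => (scal χ : (d → ℤ) → (EuclideanSpace ℂ d →L[ℂ] EuclideanSpace ℂ d)) (k - l) (g l)) :
    (conv (scal χ : (d → ℤ) → (EuclideanSpace ℂ d →L[ℂ] EuclideanSpace ℂ d)) g k) p =
      ∑' l, χ (k - l) * g l p := by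
  rw [conv_apply, show (∑' l, (scal χ : (d → ℤ) → (EuclideanSpace ℂ d →L[ℂ] EuclideanSpace ℂ d)) (k - l) (g l)) p =
      (EuclideanSpace.proj p : EuclideanSpace ℂ d →L[ℂ] ℂ)
        (∑' l, (scal χ : (d → ℤ) → (EuclideanSpace ℂ d →L[ℂ] EuclideanSpace ℂ d)) (k - l) (g l)) from rfl,
    ContinuousLinearMap.map_tsum _ hs]
  refine tsum_congr fun l => ?_
  rw [scal_apply, show ((χ (k - l) • (1 : EuclideanSpace ℂ d →L[ℂ] EuclideanSpace ℂ d)) (g l)) = χ (k - l) • g l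
    from rfl]
  rfl

omit [DecidableEq d] in
/-- **The transport family read in components is the scalar transport symbol**: for bounded scalar
families `y_j` and a target `g` whose derivatives have summable norms,
`(∑_j y_j ⋆ ∂_j g)(k)_p = transportSym y (g·_p)(k)`. -/
theorem apply_sum_conv_scal_freqDeriv {y : d → (d → ℤ) → ℂ} {g : (d → ℤ) → EuclideanSpace ℂ d}
    (hy : ∀ j, ∃ M : ℝ, ∀ q, ‖y j q‖ ≤ M) (hg : ∀ j, Summable fun l => ‖freqDeriv j g l‖) (k : d → ℤ) (p : d) :
    ((∑ j, conv (scal (y j) : (d → ℤ) → (EuclideanSpace ℂ d →L[ℂ] EuclideanSpace ℂ d)) (freqDeriv j g)) k) p =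
      transportSym y (fun m => g m p) k := by
  rw [Finset.sum_apply, transportSym_apply,
    show (∑ j, conv (scal (y j) : (d → ℤ) → (EuclideanSpace ℂ d →L[ℂ] EuclideanSpace ℂ d)) (freqDeriv j g) k) p =
      (EuclideanSpace.proj p : EuclideanSpace ℂ d →L[ℂ] ℂ)
        (∑ j, conv (scal (y j) : (d → ℤ) → (EuclideanSpace ℂ d →L[ℂ] EuclideanSpace ℂ d)) (freqDeriv j g) k) from rfl,
    map_sum]
  refine Finset.sum_congr rfl fun j _ => ?_
  obtain ⟨M, hM⟩ := hy j
  rw [show (EuclideanSpace.proj p : EuclideanSpace ℂ d →L[ℂ] ℂ)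
      (conv (scal (y j) : (d → ℤ) → (EuclideanSpace ℂ d →L[ℂ] EuclideanSpace ℂ d)) (freqDeriv j g) k) =
      (conv (scal (y j) : (d → ℤ) → (EuclideanSpace ℂ d →L[ℂ] EuclideanSpace ℂ d)) (freqDeriv j g) k) p from rfl,
    apply_conv_scal (y j) (freqDeriv j g) k p (summable_scal_conv_term hM (hg j) k),
    lconv_dsym_eq_conv_scal_freqDeriv, conv_scal_apply]
  refine tsum_congr fun l => ?_
  simp only [freqDeriv_apply, PiLp.smul_apply, smul_eq_mul]

end Components

/-! ## §2 The lattice Laplacian symbol -/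

section Laplacian

variable {d : Type*} [Fintype d]
variable {V : Type*} [NormedAddCommGroup V] [NormedSpace ℂ V]

/-- **`∑_j ∂_j∂_j u (k) = −4π²|k|² • u(k)`** on the lattice. -/
theorem sum_freqDeriv_freqDeriv_apply (u : (d → ℤ) → V) (k : d → ℤ) :
    (∑ j, freqDeriv j (freqDeriv j u)) k = (-(4 * Real.pi ^ 2 * freqNormSq k : ℝ) : ℂ) • u k := by
  rw [Finset.sum_apply]
  simp only [freqDeriv_apply, smul_smul]
  rw [← Finset.sum_smul]
  congr 1
  have hI : ∀ j : d, (2 * (Real.pi : ℂ) * Complex.I * ((k j : ℤ) : ℂ)) * (2 * (Real.pi : ℂ) * Complex.I * ((k j : ℤ) : ℂ)) =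
      -(4 * (Real.pi : ℂ) ^ 2 * ((k j : ℤ) : ℂ) ^ 2) := fun j => by
    have h2 : Complex.I * Complex.I = -1 := Complex.I_mul_I
    linear_combination (4 * (Real.pi : ℂ) ^ 2 * ((k j : ℤ) : ℂ) ^ 2) * h2
  simp only [hI, Finset.sum_neg_distrib, ← Finset.mul_sum, freqNormSq]
  push_cast
  ring

end Laplacian

/-! ## §3 The linearised field through the coordinate functionals -/

section Field

variable {d : Type*} [Fintype d] [DecidableEq d]

omit [DecidableEq d] in
/-- Components through `proj` of a rapidly decreasing `ℂ^d`-valued family are bounded scalar families. -/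
theorem exists_bound_proj_comp {u : (d → ℤ) → EuclideanSpace ℂ d} (hu : RapidDecay u) (j : d) :
    ∃ M : ℝ, ∀ q, ‖(fun m => u m j) q‖ ≤ M :=
  ⟨∑' l, ‖u l‖, fun q => (PiLp.norm_apply_le (u q) j).trans (hu.norm_le_tsum q)⟩

omit [DecidableEq d] in
/-- Derivatives of a rapidly decreasing family have summable norms. -/
theorem summable_norm_freqDeriv {u : (d → ℤ) → EuclideanSpace ℂ d} (hu : RapidDecay u) (j : d) :
    Summable fun l => ‖freqDeriv j u l‖ :=
  (hu.freqDeriv' j).summable_norm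

omit [DecidableEq d] in
/-- **The linearised field through the coordinate functionals, in the scalar-Fourier vocabulary.**
For rapidly decreasing host `Uv` and family `u` (`V = ℂ^d`, `π_j = proj j`) and every mode `k`:
`linCoeff ν Uv proj u (k) = −( ν·4π²|k|² • u(k) + [N(Uv, u)(k) + N(u, Uv)(k)] )`, where
`N(a, b)(k)_p = transportSym (j m ↦ a(m)_j) (m ↦ b(m)_p) (k)` — the convective symbols of
`SteadyLattice` / `AbcLinearisedLattice`. -/
theorem linCoeff_proj_apply {ν : ℝ} {Uv u : (d → ℤ) → EuclideanSpace ℂ d} (hUv : RapidDecay Uv) (hu : RapidDecay u)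
    (k : d → ℤ) :
    linCoeff ν Uv (fun j => (EuclideanSpace.proj j : EuclideanSpace ℂ d →L[ℂ] ℂ)) u k =
      -((((ν * (4 * Real.pi ^ 2 * freqNormSq k)) : ℝ) : ℂ) • u k +
        ((WithLp.toLp 2 (fun p : d => transportSym (fun j m => Uv m j) (fun m => u m p) k) : EuclideanSpace ℂ d) +
          (WithLp.toLp 2 (fun p : d => transportSym (fun j m => u m j) (fun m => Uv m p) k) : EuclideanSpace ℂ d))) := by
  have h1 : (∑ j, conv (scal (fun q => (EuclideanSpace.proj j : EuclideanSpace ℂ d →L[ℂ] ℂ) (Uv q)) :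
      (d → ℤ) → (EuclideanSpace ℂ d →L[ℂ] EuclideanSpace ℂ d)) (freqDeriv j u)) k =
      (WithLp.toLp 2 (fun p : d => transportSym (fun j m => Uv m j) (fun m => u m p) k) : EuclideanSpace ℂ d) := by
    ext p
    rw [PiLp.toLp_apply]
    exact apply_sum_conv_scal_freqDeriv (y := fun j m => Uv m j) (fun j => exists_bound_proj_comp hUv j)
      (summable_norm_freqDeriv hu) k p
  have h2 : (∑ j, conv (scal (fun q => (EuclideanSpace.proj j : EuclideanSpace ℂ d →L[ℂ] ℂ) (u q)) :
      (d → ℤ) → (EuclideanSpace ℂ d →L[ℂ] EuclideanSpace ℂ d)) (freqDeriv j Uv)) k =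
      (WithLp.toLp 2 (fun p : d => transportSym (fun j m => u m j) (fun m => Uv m p) k) : EuclideanSpace ℂ d) := by
    ext p
    rw [PiLp.toLp_apply]
    exact apply_sum_conv_scal_freqDeriv (y := fun j m => u m j) (fun j => exists_bound_proj_comp hu j)
      (summable_norm_freqDeriv hUv) k p
  rw [linCoeff_eq, Pi.sub_apply, Pi.sub_apply, Pi.smul_apply, sum_freqDeriv_freqDeriv_apply, h1, h2, smul_smul]
  push_cast
  rw [mul_neg, neg_smul]
  abel

end Field

/-! ## §4 The coefficients of `linOp` through `proj` and the Leray family; exact eigenvectors from the lattice eigen-equation -/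

section Operator

variable {d : Type*} [Fintype d] [DecidableEq d]

omit [DecidableEq d] in
/-- The Leray family fixes a transversal family with vanishing zero mode, modewise. -/
theorem lerayCLM_apply_of_transversal {c : (d → ℤ) → EuclideanSpace ℂ d}
    (hct : ∀ k : d → ℤ, ∑ j, ((k j : ℤ) : ℂ) * c k j = 0) (hc0 : c 0 = 0) (k : d → ℤ) :
    lerayCLM k (c k) = c k := by
  by_cases hk : k = 0
  · subst hk; rw [lerayCLM_zero, hc0, map_zero]
  · rw [lerayCLM_apply_of_ne_zero hk, Torus.leraySym_of_transversal (hct k)]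

omit [DecidableEq d] in
/-- **The coefficients of `linOp ν Uv proj lerayCLM` on a rapidly decreasing element**, in the
scalar-Fourier vocabulary: with `û = Λ⁻² ⇑x`,
`(linOp x)(k) = −Λ²(k) • Π_k ( ν·4π²|k|² û(k) + [N(Uv, û) + N(û, Uv)](k) )`. -/
theorem coe_linOp_proj_lerayCLM_apply {ν : ℝ} {Uv : (d → ℤ) → EuclideanSpace ℂ d} (hUv : RapidDecay Uv)
    {x : lp (fun _ : (d → ℤ) => EuclideanSpace ℂ d) 2} (hx : RapidDecay (⇑x)) (k : d → ℤ) :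
    (linOp ν Uv (fun j => (EuclideanSpace.proj j : EuclideanSpace ℂ d →L[ℂ] ℂ)) lerayCLM x :
        (d → ℤ) → EuclideanSpace ℂ d) k =
      -((sobolevWeight 2 k : ℂ) • lerayCLM k
        ((((ν * (4 * Real.pi ^ 2 * freqNormSq k)) : ℝ) : ℂ) • wmul (-2) (⇑x) k +
          ((WithLp.toLp 2 (fun p : d => transportSym (fun j m => Uv m j) (fun m => wmul (-2) (⇑x) m p) k) :
              EuclideanSpace ℂ d) +
            (WithLp.toLp 2 (fun p : d => transportSym (fun j m => wmul (-2) (⇑x) m j) (fun m => Uv m p) k) :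
              EuclideanSpace ℂ d)))) := by
  rw [coe_linOp_of_rapidDecay hUv norm_lerayCLM_le hx, wmul_apply,
    linCoeff_proj_apply hUv (rapidDecay_wmul hx (-2)) k, map_neg, smul_neg]

omit [DecidableEq d] in
/-- **Exact eigenvectors from the lattice eigen-equation.** If `c : ℤ^d → ℂ^d` is rapidly decaying,
transversal, mean-free and solves the tree's lattice eigen-equation
`ν·4π²|k|² c(k) + Π_k [N(Uv, c) + N(c, Uv)](k) + μ c(k) = 0` for every `k` (the hypothesis `heq` of
`SteadyLattice.isLinNSEigenvalue_of_fourier_eigen`, i.e. `L c = μ c` for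
`L = νΔ − P[(U·∇)· + (·∇)U]` on coefficients), then the scaled element `x`, `⇑x = Λ² c`, is an EXACT
EIGENVECTOR of the (β2) chain's operator: `linOp ν Uv proj lerayCLM x = μ • x`. -/
theorem linOp_eq_smul_of_fourier_eigen {ν : ℝ} {Uv : (d → ℤ) → EuclideanSpace ℂ d} (hUv : RapidDecay Uv)
    {μ : ℂ} {c : (d → ℤ) → EuclideanSpace ℂ d} (hc : RapidDecay c)
    (hct : ∀ k : d → ℤ, ∑ j, ((k j : ℤ) : ℂ) * c k j = 0) (hc0 : c 0 = 0)
    (heq : ∀ k : d → ℤ, (((ν * (4 * Real.pi ^ 2 * freqNormSq k)) : ℝ) : ℂ) • c k +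
      lerayCLM k ((WithLp.toLp 2 (fun p : d => transportSym (fun j m => Uv m j) (fun m => c m p) k) :
          EuclideanSpace ℂ d) +
        (WithLp.toLp 2 (fun p : d => transportSym (fun j m => c m j) (fun m => Uv m p) k) : EuclideanSpace ℂ d)) +
      μ • c k = 0)
    {x : lp (fun _ : (d → ℤ) => EuclideanSpace ℂ d) 2} (hx : (x : (d → ℤ) → EuclideanSpace ℂ d) = wmul 2 c) :
    linOp ν Uv (fun j => (EuclideanSpace.proj j : EuclideanSpace ℂ d →L[ℂ] ℂ)) lerayCLM x = μ • x := by
  have hxr : RapidDecay (⇑x) := by rw [hx]; exact rapidDecay_wmul hc 2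
  have hux : wmul (-2) (⇑x) = c := by
    rw [hx, wmul_wmul, show (-2 : ℝ) + 2 = 0 by norm_num, wmul_zero]
  refine linOp_eq_smul_of_coeff hUv norm_lerayCLM_le hxr fun k => ?_
  rw [hux, linCoeff_proj_apply hUv hc k, map_neg, map_add, map_smul, lerayCLM_apply_of_transversal hct hc0 k]
  exact neg_eq_of_add_eq_zero_right (heq k)

omit [DecidableEq d] in
/-- The scaled family of a rapidly decaying `c` defines an element of `E` with exactly these
coefficients: `⇑(ofCoeff (Λ² c)) = Λ² c`. -/
theorem coe_ofCoeff_wmul {V : Type*} [NormedAddCommGroup V] [NormedSpace ℂ V] {c : (d → ℤ) → V}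
    (hc : RapidDecay c) (s : ℝ) : ⇑(ofCoeff (wmul s c)) = wmul s c :=
  coe_ofCoeff_of_eNormSq_lt_top (eNormSq_lt_top_of_rapidDecay (rapidDecay_wmul hc s) 0)

end Operator

/-! ## §5 The ABC host: the certifiers' cross-product form of the coefficients of `linOp` -/

section Abc

/-- **The (β2) operator for the ABC host IS the certifiers' operator, mode by mode.** For
`Uv = 𝓕(abcFlow A B C)` and a rapidly decreasing `x ∈ E` with `û = Λ⁻² ⇑x`:
`(linOp ν Uv proj lerayCLM x)(k) = Λ²(k) • ( −ν·4π²|k|² Π_k û(k) + 2π · Π_k Σ_{s ∈ {±e_j}} Û(s) × (i(k−s) × û(k−s) − û(k−s)) )`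
— i.e. `2π·Λ²(k)` times the certifiers' `L_R û (k) = −(|k|²/R) Π_k û(k) + Π_k X û(k)` with `1/R = 2πν`
(`AbcLatticeEigenSynthesis.lerayCoeff_linSym_abcFlow`; the pairings `⟪G p, linOp p⟫` of h₁/h₂/hL in
`TransportGalerkinAbc.half_prediction_abc` are therefore pairings against this family). -/
theorem coe_linOp_abc_apply (A B C : ℝ) {ν : ℝ}
    {x : lp (fun _ : (Fin 3 → ℤ) => EuclideanSpace ℂ (Fin 3)) 2} (hx : RapidDecay (⇑x)) (k : Fin 3 → ℤ) :
    (linOp ν (mFourierCoeff (complexify ∘ Torus.abcFlow A B C))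
        (fun j => (EuclideanSpace.proj j : EuclideanSpace ℂ (Fin 3) →L[ℂ] ℂ)) lerayCLM x :
        (Fin 3 → ℤ) → EuclideanSpace ℂ (Fin 3)) k =
      (sobolevWeight 2 k : ℂ) •
        (-((((ν * (4 * Real.pi ^ 2 * freqNormSq k)) : ℝ) : ℂ) • Torus.lerayCoeff k (wmul (-2) (⇑x) k)) +
          (2 * Real.pi : ℂ) • Torus.lerayCoeff k (∑ s ∈ Torus.abcFreq, (WithLp.toLp 2 (crossProduct
            (WithLp.ofLp (Torus.abcCoeff A B C s))
            (Complex.I • crossProduct (fun j => (((k - s) j : ℤ) : ℂ)) (WithLp.ofLp (wmul (-2) (⇑x) (k - s))) -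
              WithLp.ofLp (wmul (-2) (⇑x) (k - s)))) : EuclideanSpace ℂ (Fin 3)))) := by
  rw [coe_linOp_proj_lerayCLM_apply (rapidDecay_abcHost A B C) hx k, map_add, map_smul, lerayCLM_apply,
    lerayCLM_apply, AbcLatticeEigenSynthesis.lerayCoeff_linSym_abcFlow A B C (wmul (-2) (⇑x)) k]
  rw [← smul_neg, neg_add, neg_smul, neg_neg]

end Abc

/-! ## §6 Classical eigenpairs of the linearisation, read on the lattice -/

section Classical

/-- A non-zero continuous field on `T³` has a non-zero Fourier coefficient family. -/
theorem mFourierCoeff_ne_zero {w : UnitAddTorus (Fin 3) → EuclideanSpace ℂ (Fin 3)} (hw : Continuous w)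
    (hne : w ≠ 0) : mFourierCoeff w ≠ 0 := fun h =>
  hne (eq_zero_of_forall_mFourierCoeff_eq_zero hw fun k => by rw [h]; rfl)

/-- **A classical eigenpair of the linearisation, read on the lattice** (converse of
`SteadyLattice.isLinNSEigenvalue_of_fourier_eigen`). Let `U` be a smooth real field on `T³` and let
`(μ, w, q)` solve `νΔw − (U·∇)w − (w·∇)U − ∇q = μ w` classically with `w` smooth, divergence-free and
mean-free (`Torus.LinNSResolventRel ν U μ w 0`). Then `c = 𝓕w` is rapidly decaying, transversal
(`k·c(k) = 0`), mean-free (`c(0) = 0`), and solves the lattice eigen-equation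
`ν·4π²|k|² c(k) + Π_k [N(Û, c) + N(c, Û)](k) + μ c(k) = 0` for every `k` (`Û = 𝓕U`; the pressure is
removed by `Π_k k = 0`, and `Π_k c(k) = c(k)` by transversality). -/
theorem fourier_eigen_of_linNSResolventRel {ν : ℝ} {U : UnitAddTorus (Fin 3) → EuclideanSpace ℝ (Fin 3)}
    (hU : IsSmooth U) {μ : ℂ} {w : UnitAddTorus (Fin 3) → EuclideanSpace ℂ (Fin 3)}
    (hw : Torus.LinNSResolventRel ν U μ w 0) :
    RapidDecay (mFourierCoeff w) ∧
      (∀ k : Fin 3 → ℤ, ∑ j : Fin 3, ((k j : ℤ) : ℂ) * mFourierCoeff w k j = 0) ∧ mFourierCoeff w 0 = 0 ∧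
      ∀ k : Fin 3 → ℤ, (((ν * (4 * Real.pi ^ 2 * freqNormSq k)) : ℝ) : ℂ) • mFourierCoeff w k +
        Torus.lerayCoeff k ((WithLp.toLp 2 (fun p : Fin 3 => transportSym (fun j m =>
            (mFourierCoeff (complexify ∘ U)) m j) (fun m => mFourierCoeff w m p) k) : EuclideanSpace ℂ (Fin 3)) +
          (WithLp.toLp 2 (fun p : Fin 3 => transportSym (fun j m => mFourierCoeff w m j) (fun m =>
            (mFourierCoeff (complexify ∘ U)) m p) k) : EuclideanSpace ℂ (Fin 3))) +
        μ • mFourierCoeff w k = 0 := by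
  obtain ⟨hws, hdiv, hmean, q, hqs, hE⟩ := hw
  set c : (Fin 3 → ℤ) → EuclideanSpace ℂ (Fin 3) := mFourierCoeff w with hcdef
  set a : (Fin 3 → ℤ) → EuclideanSpace ℂ (Fin 3) := mFourierCoeff (complexify ∘ U) with hadef
  have hct : ∀ k : Fin 3 → ℤ, ∑ j : Fin 3, ((k j : ℤ) : ℂ) * c k j = 0 :=
    KolmogorovShear.kdot_mFourierCoeff_eq_zero hws hdiv
  have hc0 : c 0 = 0 := mFourierCoeff_zero_of_hasZeroMean hmean
  refine ⟨hws.rapidDecay_mFourierCoeff, hct, hc0, fun k => ?_⟩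
  -- the convective part
  set M : (Fin 3 → ℤ) → EuclideanSpace ℂ (Fin 3) := fun k => (WithLp.toLp 2 (fun pp : Fin 3 => transportSym
      (fun jj mm => a mm jj) (fun mm => c mm pp) k) : EuclideanSpace ℂ (Fin 3)) + (WithLp.toLp 2 (fun pp : Fin 3 =>
      transportSym (fun jj mm => c mm jj) (fun mm => a mm pp) k) : EuclideanSpace ℂ (Fin 3)) with hMdef
  have hM : mFourierCoeff (Torus.convect U w) k + mFourierCoeff (Torus.stretch w U) k = M k := by
    rw [mFourierCoeff_convect_complex hU hws k, mFourierCoeff_stretch hU hws k]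
  -- the eigen-residual has vanishing coefficients
  set E : UnitAddTorus (Fin 3) → EuclideanSpace ℂ (Fin 3) := fun y => Torus.linearizedNSOperator ν U w q y -
      μ • w y with hEdef
  have hE0 : E = 0 := funext fun y => by rw [hEdef]; exact (hE y).trans rfl
  have c4 : Continuous fun y => Torus.gradientC q y :=
    (PiLp.continuous_toLp 2 _).comp (continuous_pi fun l => (hqs.partialDeriv l).continuous)
  have hEk : mFourierCoeff E k = (ν : ℂ) • -((((4 * Real.pi ^ 2 * freqNormSq k : ℝ)) : ℂ) • c k) - M k -
      (2 * Real.pi * Complex.I * mFourierCoeff q k) • Torus.freqVec k - μ • c k := by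
    have i1 : Integrable (fun y => laplacian w y) volume := hws.laplacian.integrable
    have i1' : Integrable ((ν : ℂ) • fun y => laplacian w y) volume := i1.smul (ν : ℂ)
    have i2 : Integrable (Torus.convect U w) volume := (hU.convect hws).integrable
    have i3 : Integrable (Torus.stretch w U) volume := (isSmooth_stretch hU hws).integrable
    have i4 : Integrable (Torus.gradientC q) volume := Continuous.integrable_unitAddTorus c4
    have i5 : Integrable (μ • w) volume := hws.integrable.smul μ
    have hfun : E = (((ν : ℂ) • fun y => laplacian w y) - (Torus.convect U w + Torus.stretch w U) -
        Torus.gradientC q) - μ • w := by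
      funext y
      simp only [hEdef, Torus.linearizedNSOperator_apply, Pi.sub_apply, Pi.add_apply, Pi.smul_apply,
        Complex.coe_smul]
    rw [hfun, mFourierCoeff_sub ((i1'.sub (i2.add i3)).sub i4) i5, mFourierCoeff_sub (i1'.sub (i2.add i3)) i4,
      mFourierCoeff_sub i1' (i2.add i3), mFourierCoeff_add i2 i3, mFourierCoeff_const_smul, hM,
      mFourierCoeff_gradientC hqs k, show (fun y => laplacian w y) = laplacian w from rfl,
      Torus.mFourierCoeff_laplacian hws k, mFourierCoeff_const_smul]
  have hz : mFourierCoeff E k = 0 := by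
    rw [hE0, show (0 : UnitAddTorus (Fin 3) → EuclideanSpace ℂ (Fin 3)) = (0 : ℂ) • (0 : UnitAddTorus (Fin 3) →
        EuclideanSpace ℂ (Fin 3)) by simp, mFourierCoeff_const_smul, zero_smul]
  rw [hz] at hEk
  -- remove the pressure with `Π_k` (`Π_k k = 0`, `Π_k c(k) = c(k)`)
  have hPc : Torus.lerayCoeff k (c k) = c k := by
    by_cases hk : k = 0
    · subst hk; rw [hc0, lerayCoeff_zero_vec]
    · exact lerayCoeff_of_kdot_eq_zero hk (hct k)
  have h2 : (((ν * (4 * Real.pi ^ 2 * freqNormSq k)) : ℝ) : ℂ) • c k + M k + μ • c k =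
      (-(2 * Real.pi * Complex.I * mFourierCoeff q k)) • Torus.freqVec k := by
    rw [neg_smul]
    push_cast at hEk ⊢
    linear_combination (norm := module) hEk
  have h3 := congrArg (Torus.lerayCoeff k) h2
  rw [lerayCoeff_add', lerayCoeff_add', lerayCoeff_smul', lerayCoeff_smul', lerayCoeff_smul', lerayCoeff_freqVec,
    smul_zero, hPc] at h3
  exact h3

end Classical

end Summit.NavierStokesRegularity.FluidComputer.TransportGalerkinEigenFourier

end
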